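import Mathlib.NumberTheory.ModularForms.Cusps
import Mathlib.Analysis.SpecialFunctions.Elliptic.Weierstrass
import Mathlib.Topology.Algebra.Group.Quotient
import Mathlib.AlgebraicGeometry.EllipticCurve.Affine.Point
import Literature.NumberTheory.EllipticCurves.Newforms
import Literature.NumberTheory.EllipticCurves.CuspFormLFunction
import Literature.NumberTheory.EllipticCurves.ModularSymbols
import Literature.NumberTheory.EllipticCurves.RealPeriod
import Literature.NumberTheory.EllipticCurves.BSDInvariants
import Literature.NumberTheory.EllipticCurves.GlobalMinimalModel
import Literature.NumberTheory.DiophantineGeometry.Conductor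
import Literature.NumberTheory.DiophantineGeometry.LocalReduction
import HarnessLib

-- D-0014 sorry-sweep (operator, 2026-08-13): sorried theorems -> named facts `def X : Prop`; partial proofs preserved in comments
-- provenance: harness21/H21/H21/Prelude/EllArithM/ModularCurve.lean @ 3cd5f34 (interim HEAD d8f2665); M5 mechanical rewrite
/-!
# The modular curve `X₀(N)` and modular parametrisations (trunk EllArithM, item C17)

Notion `modular_curve_X0N` of the gap inventory. Everything lives in `namespace Literature.ModularForms`
(OUTLINE, review 9b).

## Contents

* `Y0 N = Γ₀(N) \ ℍ`, the open modular curve as the orbit space of Mathlib's action of the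
  congruence subgroup `CongruenceSubgroup.Gamma0 N ≤ SL(2, ℤ)` on `UpperHalfPlane`, with the
  quotient topology; `X0Points N = Y0 N ⊕ CuspOrbits Γ₀(N)`, the underlying set of the compact
  Riemann surface `X₀(N)` (Mathlib `CuspOrbits`, finite for arithmetic subgroups);
  `numCusps N = #CuspOrbits Γ₀(N)`.
* The classical genus formula (Shimura Prop. 1.40, 1.43; Diamond–Shurman Thm. 3.1.1, §3.8–3.9):
  `g(X₀(N)) = 1 + μ/12 − ν₂/4 − ν₃/3 − ν_∞/2` with `μ = [PSL₂(ℤ) : Γ̄₀(N)] = N ∏_{p ∣ N} (1 + 1/p)`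
  (`gamma0Index`), `ν₂ = #{x mod N | x² + 1 ≡ 0}` (`nu₂`), `ν₃ = #{x mod N | x² + x + 1 ≡ 0}`
  (`nu₃`), `ν_∞ = ∑_{d ∣ N} φ(gcd(d, N/d))` (`nuInfty`); `genusX0 N` and the dimension formula
  `dim S₂(Γ₀(N)) = g` (`finrank_cuspForm_two_eq_genusX0`, Diamond–Shurman Thm. 3.5.1).
* `IsNeronLatticeOf W L` (`W` a Weierstrass model over `ℂ`, `L` a Mathlib `PeriodPair`):
  `g₂(L) = c₄/12`, `g₃(L) = c₆/216`, i.e. `L` is the period lattice of the invariant differential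
  `ω = dx/(2y + a₁x + a₃)` of *this* model, uniformised by
  `z ↦ (℘_L(z) − b₂/12, (℘_L'(z) − a₁x − a₃)/2)` (Silverman AEC VI.3.6, VI.5.1; same normalisation
  as item G06 `WeierstrassCurve.exists_periodPair_realPeriod_eq`). For a globally minimal model
  over `ℚ` this is the Néron lattice `Λ_E`.
* `ModularParametrizationData W N`, a **hypothesis structure** (OUTLINE §3): the newform `f` of
  `W`, a Néron lattice `L`, the uniformisation `ℂ →+ E(ℂ)` with kernel `L` (an honest field, not
  constructed: Mathlib has `℘`, `℘'` and `℘'² = 4℘³ − g₂℘ − g₃` but not the group isomorphism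
  `ℂ/Λ ≃ E(ℂ)`), the **Manin constant** as an integer field `c : ℤ` with `c Λ_f ⊆ Λ_E`
  (equivalently `φ^* ω_E = c · 2πi f(τ) dτ`; review 3 redesign), and the modular degree `deg`.
  The parametrisation `φ D : ℍ → E(ℂ)`, `τ ↦ uniformize (c · 2πi ∫_{i∞}^τ f)`, is *derived*
  (a definition), and `φ_gamma0_smul` shows it is `Γ₀(N)`-invariant.
* Named facts (`def … : Prop`, cited): existence of such data at level `N_E` for every globally
  minimal elliptic `W/ℚ` (modularity, Wiles 1995 / Breuil–Conrad–Diamond–Taylor 2001, plus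
  integrality of the Manin constant, Edixhoven 1991 Prop. 2 composed with an isogeny of Néron
  models), `maninConstant_ne_zero`, the period relation `m · Ω(W) = |c| · Ω⁺_f`
  (`realPeriodRat_dvd`), and `|c| = 1` for the optimal parametrisation of a semistable curve
  (Mazur 1978; Abbes–Ullmo 1996; Česnavičius 2018).

## Design notes

* Mathlib has `CongruenceSubgroup.Gamma0`, the actions of `SL(2, ℤ)` and `GL(2, ℝ)` on `ℍ`,
  `IsCusp`/`CuspOrbits` (with `Finite (CuspOrbits 𝒢)` for arithmetic `𝒢`), `PeriodPair`,
  `PeriodPair.lattice/weierstrassP/derivWeierstrassP/g₂/g₃` — all used. It has no modular curve as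
  a quotient, no genus formula, no dimension formula for `S₂(Γ₀(N))`, no modular parametrisation
  (searched `orbitRel.*UpperHalfPlane`, `genus`, `X0`, `modular curve`, `finrank.*CuspForm`).
* `genusX0` is the classical closed formula in `ℕ`; the truncated subtraction and the division by
  `12` occurring in it are exact for every `N ≥ 1` (this is the content of the genus formula, stated
  as `twelve_mul_genusX0`), so no junk value arises; see the docstring.
* `φBar : Y0 N → E(ℂ)` is *not* defined via `Quotient.lift`, because the invariance proof
  `φ_gamma0_smul` ultimately rests on the sorried `eichlerIntegral_smul_sub` of item C9; instead
  `deg_spec` counts `Γ₀(N)`-orbits in the fibres of `φ` directly (OUTLINE C17).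
* The outline's `surjective_φ` is **not** stated: `φ : ℍ → E(ℂ)` need not be surjective (for
  `X₀(11) ≅ E` only the cusp `∞` maps to `O`); the correct statement `(Set.range D.φ)ᶜ` finite is
  `finite_compl_range_φ`.
* Optimality of `W` (the `X₀(N)`-optimal = strong Weil curve in its isogeny class) is expressed
  isogeny-free in `abs_maninConstant_eq_one_of_isSemistable`: `D.deg ≤ D'.deg` for every
  parametrisation datum `D'` of *any* elliptic `W'/ℚ` at level `N` with the same newform
  (such `W'` are exactly the curves isogenous to `W`, by Faltings).

## References

* G. Shimura, *Introduction to the arithmetic theory of automorphic functions* (1971), §1.6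
  (Prop. 1.40, 1.43), Ch. 7 (Thm. 7.14).
* F. Diamond, J. Shurman, *A first course in modular forms*, GTM 228 (2005), Ch. 2–3
  (Thm. 3.1.1, §3.8, Thm. 3.5.1), Ch. 6 (§6.6, modular parametrisations).
* J. E. Cremona, *Algorithms for modular elliptic curves*, 2nd ed. (1997), §2.10 (computing `φ`
  and the Manin constant), §2.6–2.8.
* B. Edixhoven, *On the Manin constants of modular elliptic curves*, in *Arithmetic algebraic
  geometry (Texel, 1989)*, Progr. Math. 89, Birkhäuser (1991), 25–39, Prop. 2.
* B. Mazur, *Rational isogenies of prime degree*, Invent. Math. 44 (1978), Cor. 4.1.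
* A. Abbes, E. Ullmo, *À propos de la conjecture de Manin pour les courbes elliptiques
  modulaires*, Compositio Math. 103 (1996), Thm. A.
* K. Česnavičius, *The Manin constant in the semistable case*, Compositio Math. 154 (2018),
  Thm. 1.2.
* J. H. Silverman, *The arithmetic of elliptic curves*, GTM 106, 2nd ed., VI.3.6, VI.5.1;
  *Advanced topics*, GTM 151, IV (Néron models).
* A. Wiles, Ann. of Math. 141 (1995); C. Breuil, B. Conrad, F. Diamond, R. Taylor, JAMS 14 (2001).
-/

noncomputable section

open scoped MatrixGroups ModularForm

open CongruenceSubgroup UpperHalfPlane Complex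

namespace Literature.NumberTheory.EllipticCurves.ModularForms

/-! ### The modular curves `Y₀(N)` and `X₀(N)` -/

section Curve

variable (N : ℕ)

/-- The **open modular curve** `Y₀(N) = Γ₀(N) \ ℍ`: the space of orbits of the congruence subgroup
`Γ₀(N) ≤ SL(2, ℤ)` (Mathlib `CongruenceSubgroup.Gamma0 N`) acting on the upper half-plane by
Möbius transformations (Mathlib `UpperHalfPlane.SLAction`). It carries the quotient topology
(instance below) and is a (non-compact) Riemann surface (Shimura §1.5; Diamond–Shurman §2.1).
[folklore] -/
def Y0 : Type :=
  MulAction.orbitRel.Quotient (Gamma0 N) ℍ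

/-- The quotient topology on `Y₀(N) = Γ₀(N) \ ℍ` (Diamond–Shurman §2.1). [folklore] -/
instance : TopologicalSpace (Y0 N) :=
  inferInstanceAs (TopologicalSpace (Quotient (MulAction.orbitRel (Gamma0 N) ℍ)))

/-- The orbit map `ℍ → Y₀(N)`, `τ ↦ Γ₀(N) τ` (Diamond–Shurman §2.1). [folklore] -/
def Y0.mk (τ : ℍ) : Y0 N :=
  (Quotient.mk _ τ : MulAction.orbitRel.Quotient (Gamma0 N) ℍ)

/-- Two points of `ℍ` have the same image in `Y₀(N)` iff they are `Γ₀(N)`-equivalent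
(Diamond–Shurman §2.1). [folklore] -/
theorem Y0.mk_eq_mk_iff (τ τ' : ℍ) : Y0.mk N τ = Y0.mk N τ' ↔ ∃ γ : Gamma0 N, γ • τ' = τ :=
  Quotient.eq (r := MulAction.orbitRel (Gamma0 N) ℍ)

/-- The orbit map `ℍ → Y₀(N)` is surjective (Diamond–Shurman §2.1). [folklore] -/
theorem Y0.mk_surjective : Function.Surjective (Y0.mk N) :=
  Quotient.mk_surjective

/-- The orbit map `ℍ → Y₀(N)` is continuous for the quotient topology (Diamond–Shurman §2.1).
[folklore] -/
theorem Y0.continuous_mk : Continuous (Y0.mk N) :=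
  continuous_quotient_mk'

/-- The underlying set of the **compact modular curve** `X₀(N) = Γ₀(N) \ ℍ* = Y₀(N) ⊔ {cusps}`:
the disjoint union of `Y₀(N)` and the finite set of cusp orbits `Γ₀(N) \ ℙ¹(ℚ)` (Mathlib
`CuspOrbits`, for `Γ₀(N)` viewed in `GL(2, ℝ)`; finite by Mathlib's instance for arithmetic
subgroups). Only the underlying type is provided here; the complex structure at the cusps
(Shimura §1.5; Diamond–Shurman §2.4) is not needed by the statements. [folklore] -/
def X0Points : Type :=
  Y0 N ⊕ CuspOrbits (Gamma0 N : Subgroup (GL (Fin 2) ℝ))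

/-- The **number of cusps** `ν_∞(Γ₀(N)) = #(Γ₀(N) \ ℙ¹(ℚ))` of `X₀(N)` (Mathlib `CuspOrbits`); equal
to `∑_{d ∣ N} φ(gcd(d, N/d))` (`numCusps_eq_nuInfty`) (Shimura Prop. 1.43; Diamond–Shurman §3.8).
[folklore] -/
def numCusps : ℕ :=
  Nat.card (CuspOrbits (Gamma0 N : Subgroup (GL (Fin 2) ℝ)))

/-- The cusp orbits of `Γ₀(N)` form a finite set (Mathlib's instance for any arithmetic subgroup,
recorded as a theorem, not a new instance; Shimura Lemma 1.42). Requires `N ≠ 0` for `Γ₀(N)` to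
have finite index. In particular `0 < numCusps N`-type facts are meaningful. [folklore] -/
theorem finite_cuspOrbits_gamma0 [NeZero N] :
    Finite (CuspOrbits (Gamma0 N : Subgroup (GL (Fin 2) ℝ))) :=
  inferInstance

end Curve

/-! ### The genus formula -/

section Genus

variable (N : ℕ)

/-- The index `μ = [SL₂(ℤ) : Γ₀(N)] = [PSL₂(ℤ) : Γ̄₀(N)] = N ∏_{p ∣ N} (1 + 1/p)
= ∏_{p^e ∥ N} p^{e-1} (p + 1)`, written as a product over the factorisation of `N` (exact `ℕ`
arithmetic; `e ≥ 1` on the support) (Shimura Prop. 1.43; Diamond–Shurman §1.2, Ex. 1.2.3).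
[folklore] -/
def gamma0Index : ℕ :=
  N.factorization.prod fun p e ↦ p ^ (e - 1) * (p + 1)

/-- The number `ν₂` of elliptic points of order `2` on `X₀(N)`, equal to the number of solutions of
`x² + 1 ≡ 0 (mod N)` (this is `0` if `4 ∣ N` and `∏_{p ∣ N} (1 + (-4/p))` otherwise)
(Shimura Prop. 1.43; Diamond–Shurman Cor. 3.7.2 / Ex. 3.7.6). [folklore] -/
def nu₂ : ℕ :=
  Nat.card {x : ZMod N // x ^ 2 + 1 = 0}

/-- The number `ν₃` of elliptic points of order `3` on `X₀(N)`, equal to the number of solutions of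
`x² + x + 1 ≡ 0 (mod N)` (this is `0` if `9 ∣ N` and `∏_{p ∣ N} (1 + (-3/p))` otherwise)
(Shimura Prop. 1.43; Diamond–Shurman Cor. 3.7.2 / Ex. 3.7.6). [folklore] -/
def nu₃ : ℕ :=
  Nat.card {x : ZMod N // x ^ 2 + x + 1 = 0}

/-- The classical cusp count `ν_∞ = ∑_{d ∣ N} φ(gcd(d, N/d))` of `Γ₀(N)` (Shimura Prop. 1.43;
Diamond–Shurman §3.8). Here `N / d` is exact since `d ∣ N`. [folklore] -/
def nuInfty : ℕ :=
  ∑ d ∈ N.divisors, Nat.totient (Nat.gcd d (N / d))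

/-- The **genus of `X₀(N)`** by the classical formula
`g = 1 + μ/12 − ν₂/4 − ν₃/3 − ν_∞/2`, i.e. `12 g = 12 + μ − 3ν₂ − 4ν₃ − 6ν_∞`
(Shimura Prop. 1.40 with Prop. 1.43; Diamond–Shurman Thm. 3.1.1). The right-hand side is a
non-negative multiple of `12` for every `N ≥ 1` (Riemann–Hurwitz for `X₀(N) → X(1) ≅ ℙ¹`), so the
`ℕ`-subtraction and the division below are exact (`twelve_mul_genusX0`); for `N = 0` the value is
junk. Examples: `g(X₀(1)) = (12 + 1 − 3 − 4 − 6)/12 = 0`, `g(X₀(11)) = (12 + 12 − 0 − 0 − 12)/12 =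
1`. [folklore] -/
def genusX0 : ℕ :=
  (12 + gamma0Index N - 3 * nu₂ N - 4 * nu₃ N - 6 * nuInfty N) / 12

-- (Binder repair 2026-08-17: the former `variable [NeZero N]` of this section was captured by none
-- of the four facts below — defs keep only the section variables they use — so it is now written in
-- each header instead.)

/-- The number of cusps of `Γ₀(N)` is `∑_{d ∣ N} φ(gcd(d, N/d))` (Shimura Prop. 1.43;
Diamond–Shurman §3.8). [cite: ShimuraIATAF1971, Prop. 1.43]
(Binder repair 2026-08-17: `[NeZero N]` is written in the header so that it is a parameter of the
elaborated constant; as a section instance unused by the body it was silently dropped, so the fact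
ranged over the excluded level `N = 0`, where it is false.) -/
def numCusps_eq_nuInfty [NeZero N] : Prop :=
  numCusps N = nuInfty N

/-- `[SL₂(ℤ) : Γ₀(N)] = ∏_{p^e ∥ N} p^{e-1}(p + 1)` (Shimura Prop. 1.43; Diamond–Shurman
Ex. 1.2.3). [cite: ShimuraIATAF1971, Prop. 1.43]
(Binder repair 2026-08-17: `[NeZero N]` is written in the header so that it is a parameter of the
elaborated constant; as a section instance unused by the body it was silently dropped, so the fact
ranged over the excluded level `N = 0`, where it is false.) -/
def index_gamma0_eq_gamma0Index [NeZero N] : Prop :=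
  (Gamma0 N).index = gamma0Index N

/-- **Genus formula for `X₀(N)`**, exact form: `12 g + 3ν₂ + 4ν₃ + 6ν_∞ = 12 + μ`
(Shimura Prop. 1.40; Diamond–Shurman Thm. 3.1.1).
[cite: ShimuraIATAF1971, Prop. 1.40 with Prop. 1.43]
(Binder repair 2026-08-17: `[NeZero N]` is written in the header so that it is a parameter of the
elaborated constant; as a section instance unused by the body it was silently dropped, so the fact
ranged over the excluded level `N = 0`, where it is false.) -/
def twelve_mul_genusX0 [NeZero N] : Prop :=
  12 * genusX0 N + 3 * nu₂ N + 4 * nu₃ N + 6 * nuInfty N = 12 + gamma0Index N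

/-- **Dimension formula**: `dim_ℂ S₂(Γ₀(N)) = g(X₀(N))`, since weight-`2` cusp forms are the
holomorphic differentials on `X₀(N)` (Shimura Thm. 2.24; Diamond–Shurman Thm. 3.5.1 with `k = 2`,
§3.3). [cite: DiamondShurman2005, Thm. 3.5.1]
(Binder repair 2026-08-17: `[NeZero N]` is written in the header so that it is a parameter of the
elaborated constant; as a section instance unused by the body it was silently dropped, so the fact
ranged over the excluded level `N = 0`, where it is false.) -/
def finrank_cuspForm_two_eq_genusX0 [NeZero N] : Prop :=
  Module.finrank ℂ (CuspForm (Gamma0 N) 2) = genusX0 N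

end Genus

/-! ### Néron lattices -/

section Neron

/-- `IsNeronLatticeOf W L`: the Mathlib period pair `L = (ω₁, ω₂)` spans the period lattice of the
invariant differential `ω = dx/(2y + a₁x + a₃)` of the Weierstrass model `W` over `ℂ`, i.e.
`g₂(L) = c₄(W)/12` and `g₃(L) = c₆(W)/216`. Then `x = ℘_L(z) − b₂/12`,
`y = (℘_L'(z) − a₁x − a₃)/2` satisfy the equation of `W` (because
`(2y + a₁x + a₃)² = 4x³ + b₂x² + 2b₄x + b₆` becomes `℘'² = 4℘³ − g₂℘ − g₃`) and `z ↦ (x, y)` is an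
analytic group isomorphism `ℂ/L ≃ W(ℂ)` pulling `ω` back to `dz` (Silverman AEC VI.3.6, VI.5.1,
with the `a₁, a₃`-completion of III.1). Such an `L` exists for every elliptic `W`
(`exists_isNeronLatticeOf`) and its lattice `L.lattice ⊆ ℂ` is unique. When `W` is the base change
of a globally minimal model over `ℚ`, `ω` is the Néron differential and `L.lattice` is the
**Néron lattice** `Λ_E` (Silverman ATAEC IV.9; Cremona §3.7); the normalisation is that of item G06
`WeierstrassCurve.exists_periodPair_realPeriod_eq`. [folklore] -/
def IsNeronLatticeOf (W : WeierstrassCurve ℂ) (L : PeriodPair) : Prop :=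
  L.g₂ = W.c₄ / 12 ∧ L.g₃ = W.c₆ / 216

/-- **Uniformisation theorem** (existence of the lattice): every elliptic curve over `ℂ` has a
period pair `L` with `g₂(L) = c₄/12`, `g₃(L) = c₆/216` (Silverman AEC VI.5.1; the `j`-invariant
surjectivity plus rescaling). [cite: SilvermanAEC2009, Thm. VI.5.1] -/
def exists_isNeronLatticeOf : Prop :=
  ∀ (W : WeierstrassCurve ℂ) [W.IsElliptic],
    ∃ L : PeriodPair, IsNeronLatticeOf W L

/-- The point `(℘_L(z) − b₂/12, (℘_L'(z) − a₁x − a₃)/2)` lies on `W` and is nonsingular, for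
`z ∉ L` and `L` a Néron lattice of the elliptic curve `W/ℂ` (Silverman AEC VI.3.6(b) with the
completion of the square of III.1: `ψ(℘ − b₂/12) = 4℘³ − g₂℘ − g₃ = ℘'²`, using Mathlib
`PeriodPair.derivWeierstrassP_sq`). [cite: SilvermanAEC2009, Prop. VI.3.6(b)] -/
def IsNeronLatticeOf.nonsingular : Prop :=
  ∀ {W : WeierstrassCurve ℂ} [W.IsElliptic] {L : PeriodPair} (_ : IsNeronLatticeOf W L) {z : ℂ}
    (_ : z ∉ L.lattice),
    W.toAffine.Nonsingular (L.weierstrassP z - W.b₂ / 12)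
      ((L.derivWeierstrassP z - W.a₁ * (L.weierstrassP z - W.b₂ / 12) - W.a₃) / 2)

end Neron

/-! ### Modular parametrisations -/

section Parametrization

variable (W : WeierstrassCurve ℚ) (N : ℕ) [NeZero N]

/-- **Modular parametrisation data** for an elliptic curve `W/ℚ` at level `N` (a hypothesis
structure, OUTLINE §3): it packages

* `f`, the newform of `W` in `S₂(Γ₀(N))` (`IsNewformOf`, so `aₙ(f) = aₙ(W)` and `N = N_W`);
* `L`, a period pair spanning the Néron lattice `Λ_E` of the model `W` (`IsNeronLatticeOf`), and
  the complex uniformisation `uniformize : ℂ →+ W(ℂ)`, a surjective group homomorphism with kernel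
  `Λ_E` given off `Λ_E` by `z ↦ (℘(z) − b₂/12, (℘'(z) − a₁x − a₃)/2)` (Silverman AEC VI.3.6,
  VI.5.1) — an honest hypothesis field, since Mathlib does not yet have `ℂ/Λ ≃ E(ℂ)`;
* the **Manin constant** `c : ℤ`, characterised by `c Λ_f ⊆ Λ_E` where
  `Λ_f = periodLattice f` is the Eichler–Shimura period lattice of item C9: the modular
  parametrisation is `φ(τ) = uniformize (c · 2πi ∫_{i∞}^τ f(z) dz)`, equivalently
  `φ^* ω_E = c · 2πi f(τ) dτ` (Cremona §2.10; Edixhoven 1991, §1);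
* the **modular degree** `deg`, characterised by: all but finitely many `P ∈ E(ℂ)` have exactly
  `deg` `Γ₀(N)`-orbits of preimages under `φ` in `ℍ` (the finitely many exceptions are the branch
  values and the images of the cusps; `deg` is unique since `E(ℂ)` is infinite).

The map `φ` itself is the derived definition `ModularParametrizationData.φ`. No `[W.IsElliptic]`
argument is taken (no field needs it); the theorems about the data assume it
(Shimura Thm. 7.14; Diamond–Shurman §6.6; Cremona §2.10). [cite: EdixhovenManin1991, §1] -/
structure ModularParametrizationData where
  /-- The newform attached to `W`. -/
  f : CuspForm (Gamma0 N) 2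
  /-- `f` is the newform of `W`: `aₙ(f) = aₙ(W)` for all `n`. -/
  isNewformOf : IsNewformOf W f
  /-- A period pair spanning the Néron lattice of the model `W`. -/
  L : PeriodPair
  /-- `g₂(L) = c₄/12`, `g₃(L) = c₆/216` for the model `W` base-changed to `ℂ`. -/
  isNeronLattice : IsNeronLatticeOf (W.baseChange ℂ) L
  /-- The complex uniformisation `ℂ → ℂ/Λ_E ≃ E(ℂ)` as a group homomorphism. -/
  uniformize : ℂ →+ (W.baseChange ℂ).toAffine.Point
  /-- The kernel of the uniformisation is the Néron lattice. -/
  ker_uniformize : (uniformize.ker : Set ℂ) = L.lattice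
  /-- The uniformisation is onto `E(ℂ)`. -/
  uniformize_surjective : Function.Surjective uniformize
  /-- Off the lattice the uniformisation is `z ↦ (℘(z) − b₂/12, (℘'(z) − a₁x − a₃)/2)`
  (Silverman AEC VI.3.6 with the `a₁, a₃`-completion). -/
  uniformize_spec : ∀ z ∉ L.lattice, ∃ h,
    uniformize z = .some (W' := (W.baseChange ℂ).toAffine)
      (L.weierstrassP z - (W.baseChange ℂ).b₂ / 12)
      ((L.derivWeierstrassP z - (W.baseChange ℂ).a₁ * (L.weierstrassP z - (W.baseChange ℂ).b₂ / 12)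
        - (W.baseChange ℂ).a₃) / 2) h
  /-- The **Manin constant** of the parametrisation. -/
  c : ℤ
  /-- `c Λ_f ⊆ Λ_E`: the pull-back of the Néron differential is `c · 2πi f(τ) dτ`. -/
  smul_periodLattice_le : ∀ z ∈ periodLattice f, (c : ℂ) * z ∈ L.lattice
  /-- The **modular degree** of the parametrisation. -/
  deg : ℕ
  /-- The modular degree is positive (the parametrisation is non-constant). -/
  deg_pos : 0 < deg
  /-- All but finitely many `P ∈ E(ℂ)` have exactly `deg` orbits `Γ₀(N)τ ∈ Y₀(N)` with
  `φ(τ) = uniformize (c · 2πi ∫_{i∞}^τ f) = P`. -/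
  deg_spec : {P : (W.baseChange ℂ).toAffine.Point |
    Nat.card {y : Y0 N // ∃ τ : ℍ, Y0.mk N τ = y ∧
      uniformize ((c : ℂ) * eichlerIntegral f τ) = P} ≠ deg}.Finite

namespace ModularParametrizationData

variable {W N} (D : ModularParametrizationData W N)

/-- The **modular parametrisation** `φ : ℍ → E(ℂ)`, `φ(τ) = uniformize (c · 2πi ∫_{i∞}^τ f(z) dz)`
(`eichlerIntegral`, item C9); it is `Γ₀(N)`-invariant (`φ_gamma0_smul`) and so descends to
`X₀(N) → E` with the cusp `∞ ↦ O` (Shimura Thm. 7.14; Cremona §2.10; Diamond–Shurman §6.6).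
[folklore] -/
def φ (τ : ℍ) : (W.baseChange ℂ).toAffine.Point :=
  D.uniformize ((D.c : ℂ) * eichlerIntegral D.f τ)

/-- The **Manin constant** `c ∈ ℤ` of the parametrisation: `φ^* ω_E = c · 2πi f(τ) dτ`, i.e.
`c Λ_f ⊆ Λ_E` (Edixhoven 1991, §1; Cremona §2.10). [cite: EdixhovenManin1991, §1] -/
def maninConstant : ℤ :=
  D.c

/-- The **modular degree** `deg φ` of the parametrisation `X₀(N) → E` (Cremona §2.10; Zagier 1985).
[cite: ZagierCMB1985, §1] -/
def modularDegree : ℕ :=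
  D.deg

/-- The number of `Γ₀(N)`-orbits in `ℍ` mapping to `P` under `φ`, i.e. `#(φ̄⁻¹(P) ∩ Y₀(N))` for the
induced map `φ̄ : X₀(N) → E(ℂ)` (Diamond–Shurman §6.6). [folklore] -/
def fiberOrbitCount (P : (W.baseChange ℂ).toAffine.Point) : ℕ :=
  Nat.card {y : Y0 N // ∃ τ : ℍ, Y0.mk N τ = y ∧ D.φ τ = P}

/-- Restatement of the field `deg_spec` through `φ` and `fiberOrbitCount`: all but finitely many
points of `E(ℂ)` have exactly `deg φ` preimage orbits (Diamond–Shurman §6.6). [folklore] -/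
theorem finite_setOf_fiberOrbitCount_ne : {P | D.fiberOrbitCount P ≠ D.modularDegree}.Finite :=
  D.deg_spec

/-- The kernel of the uniformisation is the Néron lattice (membership form). [folklore] -/
theorem uniformize_eq_zero_iff (z : ℂ) : D.uniformize z = 0 ↔ z ∈ D.L.lattice := by
  rw [← SetLike.mem_coe, ← D.ker_uniformize, SetLike.mem_coe, AddMonoidHom.mem_ker]

/-- `φ` is `Γ₀(N)`-invariant: `φ(γτ) = φ(τ)` for `γ ∈ Γ₀(N)` (acting through `SL(2, ℤ)`;
`γ • τ` is definitionally `(γ : SL(2, ℤ)) • τ`), because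
`2πi ∫_{i∞}^{γτ} f − 2πi ∫_{i∞}^{τ} f ∈ Λ_f` (`eichlerIntegral_gamma_smul`, item C9), `c Λ_f ⊆ Λ_E`
(`smul_periodLattice_le`) and `Λ_E = ker uniformize`. (The proof below is complete relative to
item C9, whose `eichlerIntegral_smul_sub` is sorried; hence `φ` is not descended with
`Quotient.lift`; see `φ_gamma0_smul_holds`.) (Shimura Thm. 7.14; Cremona §2.10.)
[cite: CremonaAlgorithms1997, §2.10] -/
def φ_gamma0_smul : Prop :=
  ∀ (γ : Gamma0 N) (τ : ℍ),
    D.φ (γ • τ) = D.φ τ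

/- interim proof relied on results that are now named facts (D-0014); demoted to a fact by the D-0014 sorry-sweep, proof preserved:
:= by
  rw [← sub_eq_zero, Subgroup.smul_def, φ, φ, ← map_sub, ← mul_sub, uniformize_eq_zero_iff]
  exact D.smul_periodLattice_le _ (eichlerIntegral_gamma_smul D.f γ τ)
-/

/-- `φ_gamma0_smul` holds given the C9 fact `eichlerIntegral_gamma_smul` for `D.f` (the interim
proof, re-threaded through the named fact; Cremona §2.10). [cite: CremonaAlgorithms1997, §2.10] -/
theorem φ_gamma0_smul_holds (h : eichlerIntegral_gamma_smul D.f) : D.φ_gamma0_smul := fun γ τ ↦ by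
  rw [← sub_eq_zero, Subgroup.smul_def, φ, φ, ← map_sub, ← mul_sub, uniformize_eq_zero_iff]
  exact D.smul_periodLattice_le _ (h γ τ)

/-- `φ` is constant on `Γ₀(N)`-orbits, i.e. factors through `Y0.mk N : ℍ → Y₀(N)`
(Shimura Thm. 7.14; see `φ_eq_of_mk_eq_mk_holds`). [cite: ShimuraIATAF1971, Thm. 7.14] -/
def φ_eq_of_mk_eq_mk : Prop :=
  ∀ {τ τ' : ℍ} (_ : Y0.mk N τ = Y0.mk N τ'),
    D.φ τ = D.φ τ'

/- interim proof relied on results that are now named facts (D-0014); demoted to a fact by the D-0014 sorry-sweep, proof preserved: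
:= by
  obtain ⟨γ, rfl⟩ := (Y0.mk_eq_mk_iff N τ τ').mp h
  exact D.φ_gamma0_smul γ τ'
-/

/-- `φ_eq_of_mk_eq_mk` holds given `φ_gamma0_smul` (the interim proof, re-threaded through the
named fact; Shimura Thm. 7.14). [cite: ShimuraIATAF1971, Thm. 7.14] -/
theorem φ_eq_of_mk_eq_mk_holds (h : D.φ_gamma0_smul) : D.φ_eq_of_mk_eq_mk := fun {τ τ'} hmk ↦ by
  obtain ⟨γ, rfl⟩ := (Y0.mk_eq_mk_iff N τ τ').mp hmk
  exact h γ τ'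

/-- The Manin constant of a modular parametrisation is non-zero: if `c = 0` then `φ` is constantly
`O`, so every `P ≠ O` has no preimage, contradicting `deg_spec` with `0 < deg` since `E(ℂ)` is
infinite (Edixhoven 1991, §1). [cite: EdixhovenManin1991, §1] -/
def maninConstant_ne_zero : Prop :=
  D.maninConstant ≠ 0

/-- All but finitely many points of `E(ℂ)` are values of `φ : ℍ → E(ℂ)` (the exceptions are among
the images of the finitely many cusps; e.g. for `X₀(11) ≅ E` the origin `O = φ̄(∞)` is not a value
of `φ` on `ℍ`). Immediate from `deg_spec` and `0 < deg` (Diamond–Shurman §6.6). [folklore] -/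
theorem finite_compl_range_φ : (Set.range D.φ)ᶜ.Finite := by
  refine D.deg_spec.subset fun P hP ↦ ?_
  have : IsEmpty {y : Y0 N // ∃ τ : ℍ, Y0.mk N τ = y ∧ D.φ τ = P} :=
    ⟨fun ⟨_, τ, _, hτ⟩ ↦ hP ⟨τ, hτ⟩⟩
  change Nat.card {y : Y0 N // ∃ τ : ℍ, Y0.mk N τ = y ∧ D.φ τ = P} ≠ D.deg
  rw [Nat.card_of_isEmpty]
  exact D.deg_pos.ne

/-- The level of a modular parametrisation datum `D` is the conductor: `N = N_W`. (`_D` is an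
explicit unused binder: a `Prop`-valued `def` drops unused section variables even under
`include`, and without `D` the statement `∀ W N, N = N_W` would be false.)
(`IsNewformOf.level_eq_conductorNorm`; Carayol 1986; see `level_eq_conductorNorm_holds`).
[cite: DiamondShurman2005, Thm. 8.8.1] -/
def level_eq_conductorNorm (_D : ModularParametrizationData W N) : Prop :=
  ∀ [W.IsElliptic],
    N = W.conductorNorm ℤ

/- interim proof relied on results that are now named facts (D-0014); demoted to a fact by the D-0014 sorry-sweep, proof preserved:
:=
  IsNewformOf.level_eq_conductorNorm D.isNewformOf
-/

/-- `level_eq_conductorNorm` holds given the C16 fact `IsNewformOf.level_eq_conductorNorm` at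
level `N` (the interim proof, re-threaded through the named fact; Carayol 1986).
[cite: DiamondShurman2005, Thm. 8.8.1] -/
theorem level_eq_conductorNorm_holds (h : IsNewformOf.level_eq_conductorNorm (N := N)) :
    D.level_eq_conductorNorm :=
  h D.isNewformOf

/-- **Period relation.** `re Λ_E = ℤ · Ω(W)/2` where `Ω(W) = W.realPeriodRat` is the real period of
the model `W` including the number of real components (item G06: `Λ_E ∩ ℝ = ℤΩ₀`,
`Ω = #π₀(E(ℝ)) · Ω₀`, and `re Λ_E = ℤΩ₀` resp. `ℤ(Ω₀/2)` in the rectangular resp. rhombic case),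
and `re Λ_f = ℤ · Ω⁺_f/2` by definition of `plusPeriod` (item C9). From `c Λ_f ⊆ Λ_E` we get
`c · Ω⁺_f/2 ∈ ℤ · Ω(W)/2`, i.e. `|c| · Ω⁺_f = m · Ω(W)` for a positive integer `m` (positivity from
`Ω⁺_f > 0`, `IsNewform0.plusPeriod_pos`, and `c ≠ 0`); `m = [re Λ_E : c · re Λ_f]`. For the optimal
curve and its optimal parametrisation `m = 1` and `Ω(E) = |c| Ω⁺_f` (Cremona §2.8, §2.10;
Edixhoven 1991, §1). [cite: EdixhovenManin1991, §1] -/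
def realPeriodRat_dvd : Prop :=
  ∀ [W.IsElliptic],
    ∃ m : ℕ, 0 < m ∧ (m : ℝ) * W.realPeriodRat = |(D.maninConstant : ℝ)| * plusPeriod D.f

/-- **The Manin constant of a semistable optimal curve is `±1`.** Let `W/ℚ` be a globally minimal
model (so that `Λ_E` is the Néron lattice) of a semistable elliptic curve, and let `D` be a
parametrisation datum of minimal degree among all parametrisation data, at level `N`, of all
elliptic curves `W'/ℚ` with the same newform `f` (these `W'` are exactly the curves isogenous to
`W`, by Faltings' isogeny theorem, so the hypothesis says that `W` is the `X₀(N)`-optimal (strong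
Weil) curve of its class and `φ_D` its optimal parametrisation up to `Aut(E)`). Then `|c| = 1`.
History: `c ∈ ℤ` (Edixhoven 1991, Prop. 2, via Néron models); `p ∣ c ⇒ p² ∣ 4N` (Mazur 1978,
Cor. 4.1), so for squarefree `N` only `p = 2` can divide `c`; `c` odd if `4 ∤ N` (Abbes–Ullmo 1996,
Thm. A, with Raynaud); finally `c = ±1` for every semistable optimal `E` (Česnavičius 2018,
Thm. 1.2). Manin's conjecture (`c = ±1` for all optimal `E/ℚ`) is open in general and is *not*
asserted here. [cite: Cesnavicius2018, Thm. 1.2] -/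
def abs_maninConstant_eq_one_of_isSemistable : Prop :=
  ∀ [W.IsElliptic] [W.IsGloballyMinimal] (_ : W.IsSemistable ℤ)
    (_ : ∀ (W' : WeierstrassCurve ℚ) [W'.IsElliptic] (D' : ModularParametrizationData W' N),
      D'.f = D.f → D.modularDegree ≤ D'.modularDegree),
    |D.maninConstant| = 1

end ModularParametrizationData

/-- **Modularity with an integral Manin constant.** For every elliptic curve `E/ℚ`, given by a
globally minimal model `W` of conductor `N_E = W.conductorNorm ℤ`, there is a modular
parametrisation datum at level `N_E`: the newform `f` exists by the modularity theorem (Wiles 1995;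
Taylor–Wiles 1995; Breuil–Conrad–Diamond–Taylor 2001, Thm. A; level `= N_E` by Carayol 1986), the
Eichler–Shimura construction gives `X₀(N_E) → E_f = ℂ/Λ_f` (Shimura Thm. 7.14), `E_f` is isogenous
to `E` (Faltings 1983), and the composite `φ : X₀(N_E) → E` satisfies `φ^* ω_E = c · 2πi f dτ` with
`c ∈ ℤ`: for the optimal curve this is Edixhoven 1991, Prop. 2 (extend `φ` to the smooth locus of
the regular model of `X₀(N)` over `ℤ` and use the Néron mapping property), and an isogeny
`E_opt → E` extends to Néron models and pulls the Néron differential `ω_E` back to an integer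
multiple of `ω_{E_opt}` (Silverman ATAEC IV.6; BLR *Néron models* 7.3). `IsGloballyMinimal` makes
the lattice pinned by `IsNeronLatticeOf` the Néron lattice; `NeZero (W.conductorNorm ℤ)` holds by
`WeierstrassCurve.conductorNorm_pos` (item G22) and is taken as an instance argument.
[cite: BCDTJAMS2001, Thm. A] -/
def nonempty_modularParametrizationData : Prop :=
  ∀ (W : WeierstrassCurve ℚ) [W.IsElliptic] [W.IsGloballyMinimal] [NeZero (W.conductorNorm ℤ)],
    Nonempty (ModularParametrizationData W (W.conductorNorm ℤ))

end Parametrization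

end Literature.NumberTheory.EllipticCurves.ModularForms

end
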